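import Summits.Ventures.AbcSig.Rows.BridgeC2c
import Summits.Ventures.AbcSig.Rows.C2cL11

/-!
# Venture AbcSig — CELL `C2cL11`: p1's census predicate `Rows.C2cCell 11 ∅` from the C2c row (exponent reduction by `Rows/BridgeC2c.lean`)

HONEST FRAMING. COMPUTATION cell `pub-abcsig`; CONDITIONAL theorem; no claim on ABC or any summit. Hypotheses exactly as in
`Rows/C2cL11.lean`: `BS04Package` (CITED), `DataComplete 2816` / `RefinesCPSymAll 2816` (COMPUTED; norm-form certificates), the row's per-orbit
CITED exclusions universally quantified in `n` and `m`. Conclusion = the conjunct `Rows.C2cCell 11 ∅` of p1's `C2Part2Signed` /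
`C2Part2bSigned` (`Rows/Statements.lean`; row of record `census/rows/C2a/C2c-l11.md`): ALL `m ≥ 1` with `n ∤ m` and all
coprime distributions `A·B = 11^m` — obtained from the reduced rows (`m < n`) by `C2cCell_of_rows` (m ↦ m mod n, y ↦ ℓ^q·y).
-/

namespace Summit.Ventures.AbcSig

/-- Cell `C2cL11`: `Rows.C2cCell 11 ∅` under the row's hypotheses. -/
theorem xcell_C2cL11 (M : NewformModel) (hP : M.BS04Package)
    (hD2816 : M.DataComplete 2816 level2816Orbits) (hCP2816 : M.RefinesCPSymAll 2816 level2816CP)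
 :
    Rows.C2cCell 11 ∅ :=
  C2cCell_of_rows 11 (by norm_num) (by norm_num) _
    (fun n hn h11 hnℓ _ m hm hmn x y z h1 h2 =>
      xrow_C2cL11 M hP hD2816 hCP2816 n hn h11 hnℓ  m hm hmn  x y z h1 h2)

end Summit.Ventures.AbcSig
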